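import Summits.QuantumAdvantage.QuantumAdvantage.Theorems.CharDialTwoBlockMoebius
import Summits.QuantumAdvantage.QuantumAdvantage.Theorems.CharDialFrobPlane
import HarnessLib

/-!
# TwoBlockFrob — the Frobenius structure law on the TWO-BLOCK-SYMMETRIC class (all `n`, all `p`)

(decomp-qadv-lens-6 g8; Part 2 of 2, see `TwoBlockMoebius.lean` for the combinatorial lemmas.)
`SubChar.twoBlock_frob` / `SubChar.twoBlock_frob_law`: a Boolean function of two disjoint block weights
(`|A|, |B| ≥ p − 1`) of `𝔽_p`-degree `≤ p − 1` is `h(a·wt_A + b·wt_B mod p)` — the CharDial node's `FrobStructureLaw`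
shape with `J = ∅` and a coefficient vector constant on each block.
-/

namespace Summit.QuantumAdvantage.AdviceFreeQNC0

/-! ### The two-block structure theorem -/

namespace SubChar

open Finset MvPolynomial
open Literature.Computability.MetaComplexity Literature.Computability.MetaComplexity.Smolensky
open SubLog FrobPlane

variable {n : ℕ}

/-- **The Frobenius structure law on the two-block-symmetric class.** -/
theorem twoBlock_frob (p : ℕ) [hp : Fact p.Prime] {A B : Finset (Fin n)} (hAB : Disjoint A B)
    (hA : p - 1 ≤ A.card) (hB : p - 1 ≤ B.card) (f : (Fin n → Bool) → Bool)
    (hsym : ∀ u v : Fin n → Bool, bw A u = bw A v → bw B u = bw B v → f u = f v)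
    (hf : HasDegF p f (p - 1)) :
    ∃ (a b : ZMod p) (h : ZMod p → Bool), ∀ u,
      f u = h (a * (∑ i ∈ A, if u i then (1 : ZMod p) else 0) + b * (∑ i ∈ B, if u i then (1 : ZMod p) else 0)) := by
  classical
  have hp1 : 1 < p := hp.out.one_lt
  -- the profile of f
  let Φ : ℕ → ℕ → Bool := fun i j =>
    if h : ∃ u : Fin n → Bool, bw A u = i ∧ bw B u = j then f (Classical.choose h) else false
  have hΦ : ∀ u, f u = Φ (bw A u) (bw B u) := by
    intro u
    have h : ∃ v : Fin n → Bool, bw A v = bw A u ∧ bw B v = bw B u := ⟨u, rfl, rfl⟩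
    simp only [Φ, dif_pos h]
    obtain ⟨h1, h2⟩ := Classical.choose_spec h
    exact hsym u _ h1.symm h2.symm
  -- realizing sets: X ⊆ A of size i, Y ⊆ B of size j
  have hreal : ∀ i j, i ≤ A.card → j ≤ B.card → ∃ T ⊆ A ∪ B, (T ∩ A).card = i ∧ (T ∩ B).card = j := by
    intro i j hi hj
    obtain ⟨X, hXA, hXc⟩ := Finset.exists_subset_card_eq hi
    obtain ⟨Y, hYB, hYc⟩ := Finset.exists_subset_card_eq hj
    refine ⟨X ∪ Y, union_subset_union hXA hYB, ?_, ?_⟩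
    · rw [union_inter_distrib_right, inter_eq_left.2 hXA,
        disjoint_iff_inter_eq_empty.1 (hAB.symm.mono_left hYB), union_empty, hXc]
    · rw [union_inter_distrib_right, inter_eq_left.2 hYB,
        disjoint_iff_inter_eq_empty.1 (hAB.mono_left hXA), empty_union, hYc]
  -- the indicator and its Möbius coefficients
  let g : (Fin n → Bool) → ZMod p := indR (ZMod p) f
  have hg_mem : g ∈ lowDeg (ZMod p) n (p - 1) := (hasDegF_iff_indR p f (p - 1)).1 hf
  let Φh : ℕ → ℕ → ZMod p := fun i j => if Φ i j = true then 1 else 0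
  have hgvert : ∀ T ⊆ A ∪ B, g (vert T) = Φh (T ∩ A).card (T ∩ B).card := by
    intro T _
    simp only [g, indR, Φh, hΦ (vert T), bw_vert]
  have hmoeb : ∀ S ⊆ A ∪ B, moeb g S = gam Φh (S ∩ A).card (S ∩ B).card :=
    fun S hS => moeb_twoBlock hAB g Φh hgvert hS
  -- γ(i,j) = 0 for i + j ≥ p (degree test)
  have hgam0 : ∀ i j, i < p → j < p → p ≤ i + j → gam Φh i j = 0 := by
    intro i j hi hj hij
    obtain ⟨S, hS, hSA, hSB⟩ := hreal i j (by omega) (by omega)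
    rw [← hSA, ← hSB, ← hmoeb S hS]
    refine moeb_eq_zero_of_mem_lowDeg hg_mem ?_
    rw [card_eq_twoBlock hAB hS, hSA, hSB]; omega
  -- the interpolating polynomial
  let idx : Finset (ℕ × ℕ) := (range p ×ˢ range p).filter fun q => q.1 + q.2 ≤ p - 1
  let P : MvPolynomial (Fin 2) (ZMod p) :=
    ∑ q ∈ idx, MvPolynomial.C (gam Φh q.1 q.2) * (binomP 0 q.1 * binomP 1 q.2)
  have hdeg : P.totalDegree ≤ p - 1 := by
    refine (totalDegree_finsetSum _ _).trans (Finset.sup_le fun q hq => ?_)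
    have hq' := (mem_filter.1 hq).2
    refine (totalDegree_mul _ _).trans ?_
    rw [totalDegree_C, zero_add]
    refine (totalDegree_mul _ _).trans ?_
    exact (Nat.add_le_add (totalDegree_binomP 0 q.1) (totalDegree_binomP 1 q.2)).trans hq'
  -- evaluation of P at a point of 𝔽_p²
  have hevalP : ∀ x : Fin 2 → ZMod p, MvPolynomial.eval x P =
      ∑ i ∈ range p, ∑ j ∈ range p,
        (((x 0).val.choose i : ℕ) : ZMod p) * ((((x 1).val.choose j : ℕ) : ZMod p) * gam Φh i j) := by
    intro x
    simp only [P, MvPolynomial.eval_sum, MvPolynomial.eval_mul, MvPolynomial.eval_C]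
    rw [Finset.sum_filter, Finset.sum_product]
    refine Finset.sum_congr rfl fun i hi => Finset.sum_congr rfl fun j hj => ?_
    have hi' := mem_range.1 hi
    have hj' := mem_range.1 hj
    by_cases hq : i + j ≤ p - 1
    · rw [if_pos hq, eval_binomP x 0 hi', eval_binomP x 1 hj']; ring
    · rw [if_neg hq, hgam0 i j hi' hj' (by omega)]; ring
  -- the profile at small weights, via Möbius inversion
  have hprof : ∀ s t : ℕ, s < p → t < p →
      (if Φ s t = true then (1 : ZMod p) else 0) =
        ∑ i ∈ range p, ∑ j ∈ range p,
          ((s.choose i : ℕ) : ZMod p) * (((t.choose j : ℕ) : ZMod p) * gam Φh i j) := by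
    intro s t hs ht
    obtain ⟨T, hT, hTA, hTB⟩ := hreal s t (by omega) (by omega)
    have h1 : (if Φ s t = true then (1 : ZMod p) else 0) = g (vert T) := by
      rw [hgvert T hT, hTA, hTB]
    rw [h1, ← sum_moeb_powerset g T]
    have h2 : ∑ S ∈ T.powerset, moeb g S = ∑ S ∈ T.powerset, gam Φh (S ∩ A).card (S ∩ B).card :=
      Finset.sum_congr rfl fun S hS => hmoeb S ((mem_powerset.1 hS).trans hT)
    rw [h2, sum_powerset_twoBlock hAB hT (gam Φh), hTA, hTB]
    -- extend the ranges from s+1, t+1 to p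
    have hext : ∀ (m : ℕ) (hm : m < p) (F : ℕ → ZMod p),
        ∑ i ∈ range (m + 1), m.choose i • F i = ∑ i ∈ range p, ((m.choose i : ℕ) : ZMod p) * F i := by
      intro m hm F
      rw [← Finset.sum_subset (Finset.range_subset_range.2 (by omega : m + 1 ≤ p))]
      · exact Finset.sum_congr rfl fun i _ => by rw [nsmul_eq_mul]
      · intro i _ hi
        rw [mem_range, not_lt] at hi
        rw [Nat.choose_eq_zero_of_lt (by omega), Nat.cast_zero, zero_mul]
    rw [hext s hs]
    refine Finset.sum_congr rfl fun i _ => ?_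
    rw [hext t ht, Finset.mul_sum]
  -- Boolean profile on 𝔽_p² and FrobPlane
  let G : (Fin 2 → ZMod p) → Bool := fun x => Φ (x 0).val (x 1).val
  have hP : ∀ x, MvPolynomial.eval x P = if G x then 1 else 0 := by
    intro x
    rw [hevalP x]
    exact (hprof (x 0).val (x 1).val (ZMod.val_lt _) (ZMod.val_lt _)).symm
  obtain ⟨a, b, h, hGh⟩ := frobPlane p G P hdeg hP
  -- periodicity of the profile in each block weight
  have hperA : ∀ i j, i + p ≤ A.card → j ≤ B.card → Φ (i + p) j = Φ i j := by
    intro i j hi hj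
    obtain ⟨T, hT, hTA, hTB⟩ := hreal i j (by omega) hj
    let u : Fin n → Bool := vert T
    have huA : bw A u = i := by rw [bw_vert, hTA]
    have huB : bw B u = j := by rw [bw_vert, hTB]
    have hZ : p ≤ (A.filter fun k => u k = false).card := by
      have h1 : (A.filter fun k => u k = false) = A \ (A.filter fun k => u k = true) := by
        ext k; by_cases hk : k ∈ A <;> simp [hk]
      rw [h1, card_sdiff_of_subset (filter_subset _ _)]
      have : (A.filter fun k => u k = true).card = i := huA
      omega
    obtain ⟨Y, hYsub, hYcard⟩ := Finset.exists_subset_card_eq hZ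
    have hYA : Y ⊆ A := hYsub.trans (filter_subset _ _)
    have hY0 : ∀ k ∈ Y, u k = false := fun k hk => (mem_filter.1 (hYsub hk)).2
    have hYB : Y ∩ B = ∅ := disjoint_iff_inter_eq_empty.1 (hAB.mono_left hYA)
    have hwA : ∀ T' ⊆ Y, bw A (setOn T' u) = i + T'.card := by
      intro T' hT'
      rw [bw_setOn (fun k hk => hY0 k (hT' hk)), huA, inter_eq_left.2 (hT'.trans hYA)]
    have hwB : ∀ T' ⊆ Y, bw B (setOn T' u) = j := by
      intro T' hT'
      rw [bw_setOn (fun k hk => hY0 k (hT' hk)), huB]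
      have : T' ∩ B = ∅ := by
        rw [← subset_empty, ← hYB]; exact inter_subset_inter_right hT'
      rw [this, card_empty, add_zero]
    have hblock := block_periodic p (d := p - 1) (by omega) hf u Y hYcard hY0
      (fun T₁ hT₁ T₂ hT₂ hc => hsym _ _ (by rw [hwA T₁ hT₁, hwA T₂ hT₂, hc]) (by rw [hwB T₁ hT₁, hwB T₂ hT₂]))
    have e1 : f (setOn Y u) = Φ (i + p) j := by rw [hΦ, hwA Y (Subset.refl _), hwB Y (Subset.refl _), hYcard]
    have e2 : f u = Φ i j := by rw [hΦ, huA, huB]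
    rw [← e1, ← e2, hblock]
  have hperB : ∀ i j, i ≤ A.card → j + p ≤ B.card → Φ i (j + p) = Φ i j := by
    intro i j hi hj
    obtain ⟨T, hT, hTA, hTB⟩ := hreal i j hi (by omega)
    let u : Fin n → Bool := vert T
    have huA : bw A u = i := by rw [bw_vert, hTA]
    have huB : bw B u = j := by rw [bw_vert, hTB]
    have hZ : p ≤ (B.filter fun k => u k = false).card := by
      have h1 : (B.filter fun k => u k = false) = B \ (B.filter fun k => u k = true) := by
        ext k; by_cases hk : k ∈ B <;> simp [hk]
      rw [h1, card_sdiff_of_subset (filter_subset _ _)]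
      have : (B.filter fun k => u k = true).card = j := huB
      omega
    obtain ⟨Y, hYsub, hYcard⟩ := Finset.exists_subset_card_eq hZ
    have hYB : Y ⊆ B := hYsub.trans (filter_subset _ _)
    have hY0 : ∀ k ∈ Y, u k = false := fun k hk => (mem_filter.1 (hYsub hk)).2
    have hYA : Y ∩ A = ∅ := disjoint_iff_inter_eq_empty.1 (hAB.symm.mono_left hYB)
    have hwB : ∀ T' ⊆ Y, bw B (setOn T' u) = j + T'.card := by
      intro T' hT'
      rw [bw_setOn (fun k hk => hY0 k (hT' hk)), huB, inter_eq_left.2 (hT'.trans hYB)]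
    have hwA : ∀ T' ⊆ Y, bw A (setOn T' u) = i := by
      intro T' hT'
      rw [bw_setOn (fun k hk => hY0 k (hT' hk)), huA]
      have : T' ∩ A = ∅ := by
        rw [← subset_empty, ← hYA]; exact inter_subset_inter_right hT'
      rw [this, card_empty, add_zero]
    have hblock := block_periodic p (d := p - 1) (by omega) hf u Y hYcard hY0
      (fun T₁ hT₁ T₂ hT₂ hc => hsym _ _ (by rw [hwA T₁ hT₁, hwA T₂ hT₂]) (by rw [hwB T₁ hT₁, hwB T₂ hT₂, hc]))
    have e1 : f (setOn Y u) = Φ i (j + p) := by rw [hΦ, hwA Y (Subset.refl _), hwB Y (Subset.refl _), hYcard]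
    have e2 : f u = Φ i j := by rw [hΦ, huA, huB]
    rw [← e1, ← e2, hblock]
  have hmod : ∀ i j, i ≤ A.card → j ≤ B.card → Φ i j = Φ (i % p) (j % p) := by
    have hmodA : ∀ i j, i ≤ A.card → j ≤ B.card → Φ i j = Φ (i % p) j := by
      intro i
      induction i using Nat.strong_induction_on with
      | _ i ih =>
        intro j hi hj
        by_cases hlt : i < p
        · rw [Nat.mod_eq_of_lt hlt]
        · have hpi : p ≤ i := Nat.le_of_not_lt hlt
          have h1 : Φ i j = Φ (i - p) j := by
            have := hperA (i - p) j (by omega) hj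
            rwa [Nat.sub_add_cancel hpi] at this
          rw [h1, ih (i - p) (by omega) j (by omega) hj, Nat.mod_eq_sub_mod hpi]
    have hmodB : ∀ j i, i ≤ A.card → j ≤ B.card → Φ i j = Φ i (j % p) := by
      intro j
      induction j using Nat.strong_induction_on with
      | _ j ih =>
        intro i hi hj
        by_cases hlt : j < p
        · rw [Nat.mod_eq_of_lt hlt]
        · have hpj : p ≤ j := Nat.le_of_not_lt hlt
          have h1 : Φ i j = Φ i (j - p) := by
            have := hperB i (j - p) hi (by omega)
            rwa [Nat.sub_add_cancel hpj] at this
          rw [h1, ih (j - p) (by omega) i hi (by omega), Nat.mod_eq_sub_mod hpj]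
    intro i j hi hj
    rw [hmodA i j hi hj, hmodB j (i % p) ((Nat.mod_le i p).trans hi) hj]
  -- assemble
  refine ⟨a, b, h, fun u => ?_⟩
  let x₀ : Fin 2 → ZMod p := fun k => if k = 0 then (bw A u : ZMod p) else (bw B u : ZMod p)
  have hx : G x₀ = f u := by
    show Φ (x₀ 0).val (x₀ 1).val = f u
    rw [hΦ u, hmod _ _ (bw_le A u) (bw_le B u)]
    simp [x₀, ZMod.val_natCast]
  have h2 : f u = h (a * x₀ 0 + b * x₀ 1) := hx.symm.trans (hGh x₀)
  rw [h2]
  simp [x₀, natCast_bw]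

/-- The same in the CharDial node's `FrobStructureLaw` shape: ONE coefficient vector (constant on each block,
zero elsewhere) and `J = ∅`. -/
theorem twoBlock_frob_law (p : ℕ) [hp : Fact p.Prime] {A B : Finset (Fin n)} (hAB : Disjoint A B)
    (hA : p - 1 ≤ A.card) (hB : p - 1 ≤ B.card) (f : (Fin n → Bool) → Bool)
    (hsym : ∀ u v : Fin n → Bool, bw A u = bw A v → bw B u = bw B v → f u = f v)
    (hf : HasDegF p f (p - 1)) :
    ∃ (c : Fin n → ZMod p) (h : ZMod p → Bool), ∀ u, f u = h (∑ i, if u i then c i else 0) := by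
  classical
  obtain ⟨a, b, h, hh⟩ := twoBlock_frob p hAB hA hB f hsym hf
  refine ⟨fun i => if i ∈ A then a else if i ∈ B then b else 0, h, fun u => ?_⟩
  rw [hh u]
  congr 1
  have hsplit : ∀ i : Fin n, (if u i then (if i ∈ A then a else if i ∈ B then b else 0) else 0)
      = a * (if i ∈ A then (if u i then 1 else 0) else 0) + b * (if i ∈ B then (if u i then 1 else 0) else 0) := by
    intro i
    by_cases hiA : i ∈ A
    · have hiB : i ∉ B := fun hiB => disjoint_left.1 hAB hiA hiB
      simp [hiA, hiB]
    · by_cases hiB : i ∈ B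
      · simp [hiA, hiB]
      · simp [hiA, hiB]
  have hA' : (∑ i ∈ A, if u i then (1 : ZMod p) else 0) = ∑ i, if i ∈ A then (if u i then (1 : ZMod p) else 0) else 0 := by
    rw [Finset.sum_ite_mem, Finset.univ_inter]
  have hB' : (∑ i ∈ B, if u i then (1 : ZMod p) else 0) = ∑ i, if i ∈ B then (if u i then (1 : ZMod p) else 0) else 0 := by
    rw [Finset.sum_ite_mem, Finset.univ_inter]
  rw [hA', hB', Finset.mul_sum, Finset.mul_sum, ← Finset.sum_add_distrib]
  refine Finset.sum_congr rfl fun i _ => ?_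
  simp only
  exact (hsplit i).symm

end SubChar

end Summit.QuantumAdvantage.AdviceFreeQNC0
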